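import Summits.BirchSwinnertonDyer.BirchSwinnertonDyer.Theorems.ErratumRoadFiveEulerHalfGenusClassDefs
import Summits.BirchSwinnertonDyer.BirchSwinnertonDyer.Theorems.KolyvaginDepthDoorKolyvaginDepthSupplyZhangGrossPow
import Literature.NumberTheory.EllipticCurves.BSDSelmerPConverseSerreProofs
import HarnessLib

/-!
# ErratumRoadFive ∕ EulerHalf ∕ genus line — (b2b-κ) adapter B: the KOLYVAGIN-PRIME CURRENCY on a served frame
# (helper, `--supports 23444`)

Cell bsd-stepL, prover seat `bsd-stepL-imc-p1` g42; plan `HOME/imc-p1/g42/B2BK-ASSEMBLY-PLAN-imc-p1-g42.md` §4 B ∕ §6.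

WHAT.  The class-data child `GenusLine.GenusClassDataSupply` quantifies over W. ZHANG's Kolyvagin primes and indices
(`Zhang2014.IsKolyvaginPrime N_W W K p ℓ`, `k ≤ M(ℓ)`, levels with `k ≤ M(c)`), while the CR3 family class package it is assembled
from (`…ShimuraFamilySign ∕ Stringent ∕ Transverse ∕ H47Orders[Guard]`) takes GROSS's currency at depth `k`
(`IsKolyvaginPrime N W K p q ∧ FrobEqFrobInfty W K (p ^ k) q` for every prime `q` of the level).  On a served frame
(`GenusLine.FrameProfile`: `5 ≤ p`, `ρ̄_{W,p}` onto, `K` imaginary quadratic) the conversion is BY NAME: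
tower-surjectivity is Serre's lemma, PROVED in the tree (`serre_hasSurjectiveModNGaloisRep_pow_holds`, `p ≥ 5`), and Zhang ⟹ Gross at
depth `k` is `KolyvaginDepthDoor.isKolyvaginPrime_and_frobEqFrobInfty_pow_of_zhang`.  Also recorded: such levels avoid the label
guard `2N_W` of `GenusLine.GenusLabelsSupplyOdd` (Defs III″ §5).
* `hasSurjectiveModNGaloisRep_pow_of_frameProfile` — `ρ̄_{W,p^n}` onto for every `n`.
* `grossKolyvagin_of_zhang_of_frameProfile` — one prime, depth `k ≤ M(ℓ)`, `1 ≤ k`.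
* `grossKolyvagin_level_of_frameProfile` — every prime of a level `n` with `k ≤ M(n)` (`Zhang2014.levelIndex`).
* `not_dvd_two_mul_level_of_frameProfile` — every prime of such a level avoids `2 * N_W`.

HONEST FRAMING: glue by name; no crux and no stub is closed; BSD is proved for no curve.
[cite: GrossLMS1991, §3 (3.1)–(3.3)] [cite: WZhang2014, Notations (xii)] [cite: SerreAbelianLadic1968, Ch. IV §3.4, Lemma 3]
presearch: in-tree only (`frobEqFrobInfty_pow_of_zhang`, `serre_hasSurjectiveModNGaloisRep_pow_holds`); no new literature.
-/

set_option autoImplicit false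
-- D-0017: single-problem summit, so `Summit.BirchSwinnertonDyer.BirchSwinnertonDyer.…` repeats a namespace BY DESIGN.
set_option linter.dupNamespace false

noncomputable section

open scoped Classical
open WeierstrassCurve NumberField Literature.NumberTheory.EllipticCurves

namespace Summit.BirchSwinnertonDyer.BirchSwinnertonDyer.Theorems.GenusLine

variable {W A : WeierstrassCurve ℚ} [W.IsElliptic] [W.IsGloballyMinimal] [A.IsElliptic]
  {p q : ℕ} [Fact p.Prime] [Fact q.Prime] {K : Type} [Field K] [NumberField K]

/-- **Tower-surjectivity on a served frame**: `ρ̄_{W,p^n}` is onto for every `n` (Serre's lemma at `p ≥ 5` from `ρ̄_{W,p}` onto —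
the tree's `serre_hasSurjectiveModNGaloisRep_pow_holds`). [cite: SerreAbelianLadic1968, Ch. IV §3.4, Lemma 3] -/
theorem hasSurjectiveModNGaloisRep_pow_of_frameProfile (hprof : FrameProfile W A p q K) (n : ℕ) :
    W.HasSurjectiveModNGaloisRep (p ^ n : ℕ) :=
  serre_hasSurjectiveModNGaloisRep_pow_holds W p hprof.five_le hprof.surj n

/-- `p` is odd on a served frame (`5 ≤ p`). [folklore] -/
theorem p_ne_two_of_frameProfile (hprof : FrameProfile W A p q K) : p ≠ 2 := by
  have := hprof.five_le; omega

/-- `p ≠ 3` on a served frame (`5 ≤ p`). [folklore] -/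
theorem p_ne_three_of_frameProfile (hprof : FrameProfile W A p q K) : p ≠ 3 := by
  have := hprof.five_le; omega

/-- **Zhang ⟹ Gross at depth `k` on a served frame**: a W. Zhang Kolyvagin prime `ℓ` with `k ≤ M(ℓ)`, `1 ≤ k`, is a Gross
Kolyvagin prime with `Frob(ℓ) = Frob(∞)` on `W[p^k]` and on `K`. [cite: GrossLMS1991, §3 (3.1)–(3.3)] [cite: WZhang2014, Notations (xii)] -/
theorem grossKolyvagin_of_zhang_of_frameProfile (hprof : FrameProfile W A p q K) {k ℓ : ℕ} (hk : 1 ≤ k)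
    (hℓ : Zhang2014.IsKolyvaginPrime (W.conductorNorm ℤ) W K p ℓ) (hℓk : k ≤ Zhang2014.kolyvaginIndex W p ℓ) :
    IsKolyvaginPrime (W.conductorNorm ℤ) W K p ℓ ∧ FrobEqFrobInfty W K (p ^ k) ℓ :=
  KolyvaginDepthDoor.isKolyvaginPrime_and_frobEqFrobInfty_pow_of_zhang W K hprof.quad (p_ne_two_of_frameProfile hprof) hk
    hprof.surj (hasSurjectiveModNGaloisRep_pow_of_frameProfile hprof k) hℓ hℓk

/-- **The same at every prime of a Zhang–Kolyvagin level `n` with `k ≤ M(n)`** (`Zhang2014.levelIndex`; the shape `hKol` the CR3 family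
theorems take). [cite: GrossLMS1991, §3 (3.1)–(3.3)] [cite: WZhang2014, Notations (xii)] -/
theorem grossKolyvagin_level_of_frameProfile (hprof : FrameProfile W A p q K) {k n : ℕ} (hk : 1 ≤ k)
    (hKol : ∀ ℓ ∈ n.primeFactors, Zhang2014.IsKolyvaginPrime (W.conductorNorm ℤ) W K p ℓ)
    (hkn : (k : ℕ∞) ≤ Zhang2014.levelIndex W p n) :
    ∀ ℓ ∈ n.primeFactors, IsKolyvaginPrime (W.conductorNorm ℤ) W K p ℓ ∧ FrobEqFrobInfty W K (p ^ k) ℓ :=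
  fun ℓ hℓ ↦ grossKolyvagin_of_zhang_of_frameProfile hprof hk (hKol ℓ hℓ) (Zhang2014.natCast_le_levelIndex_iff.mp hkn ℓ hℓ)

/-- **A Zhang–Kolyvagin level avoids the label guard `2N_W` on a served frame** (its primes are odd for `p ≠ 3` and prime to `N_W`):
the `hKolN'` binder of `ShimuraWalk.addOrderOf_localization_kolyvaginClass_familyData_eq_of_labelsGuard` at `N' = 2 * N_W`.
[cite: WZhang2014, Notations (xii)] -/
theorem not_dvd_two_mul_level_of_frameProfile (hprof : FrameProfile W A p q K) {n : ℕ}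
    (hKol : ∀ ℓ ∈ n.primeFactors, Zhang2014.IsKolyvaginPrime (W.conductorNorm ℤ) W K p ℓ) :
    ∀ ℓ ∈ n.primeFactors, ¬ ℓ ∣ 2 * W.conductorNorm ℤ :=
  fun ℓ hℓ ↦ not_dvd_two_mul_of_isKolyvaginPrime (hKol ℓ hℓ) (Fact.out : p.Prime) (p_ne_three_of_frameProfile hprof)

/-- **The inert-prime guard at `2N_W`** in the shape `familyLabels_of_labelsAt` ∕ `exists_coherent_familyData_y_eq` take
(`¬ q ∣ N' ∧ (q)` prime in `𝓞_K`). [cite: WZhang2014, Notations (xii)] -/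
theorem guard_two_mul_level_of_frameProfile (hprof : FrameProfile W A p q K) {n : ℕ}
    (hKol : ∀ ℓ ∈ n.primeFactors, Zhang2014.IsKolyvaginPrime (W.conductorNorm ℤ) W K p ℓ) :
    ∀ ℓ ∈ n.primeFactors, ¬ ℓ ∣ 2 * W.conductorNorm ℤ ∧ (Ideal.span {(ℓ : 𝓞 K)}).IsPrime :=
  fun ℓ hℓ ↦ ⟨not_dvd_two_mul_level_of_frameProfile hprof hKol ℓ hℓ, (hKol ℓ hℓ).2.2.2.2.1⟩

end Summit.BirchSwinnertonDyer.BirchSwinnertonDyer.Theorems.GenusLine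

end
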